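import Summits.ValiantsHypothesis.ValiantsHypothesis.Theorems.LacunarySymmetroidMatrixDescartesCensusSidonBox20D
import Summits.ValiantsHypothesis.ValiantsHypothesis.Theorems.LacunarySymmetroidMatrixDescartesCensusV19SShells2122R3
import Summits.ValiantsHypothesis.ValiantsHypothesis.Theorems.LacunarySymmetroidMatrixDescartesCensusV19SShells2324R2
import Summits.ValiantsHypothesis.ValiantsHypothesis.Theorems.LacunarySymmetroidMatrixDescartesCensusV19CShells2324
import Summits.ValiantsHypothesis.ValiantsHypothesis.Theorems.LacunarySymmetroidMatrixDescartesCensusV19SBox22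

/-!
# `MatrixDescartes` census — the BOX-24 EIGHTEEN STATEMENT minus NAMED EXCEPTIONS, in the kernel (assembly; sorted and window forms)

HONEST FRAMING.  Object-search cell `pub-symmetroid`; door-A item `DoorA26 = PosRootLawAt 2 6 19` (stmt-ValiantsHypothesis-19979; OPEN, typed, never asserted)
and its sharper support rows `PosRootLawOn 2 6 18 d`.  ASSEMBLY (val-sym-door-p4 g6) of kernel pieces into `Census.eighteen_box24_sorted_of_not_mem`: every sorted
support `0 = d₀ < ⋯ < d₅ ≤ 24` outside the NAMED EXCEPTION LISTS has `ζ(2,6; d) ≤ 18 = D(2,6) − 2` — 2-Sidon supports with `d₅ ≤ 20` by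
`Census.doorA26_sidon_box20` (…SidonBox20D, val-sym-door-p5 g5: NO exceptions), 2-Sidon supports with `d₅ ∈ {21, 22}` by `V19S.eighteen_sidon_shells2122R3_sorted` (exceptions `V19S.s2122OpenR3`),
2-Sidon supports with `d₅ ∈ {23, 24}` by `V19S.eighteen_sidon_shells2324R2_sorted` (exceptions `V19S.s2324OpenR2`), one-collision supports by `V19C.caseC_box24_sorted`
(exceptions `V19C.caseC18Open ++ V19C.caseC20Open ++ V19C.caseC22Open ++ V19C.caseC2324Open`), supports with `≤ 19` distinct pair sums by Descartes
(`Census.doorA26_box18_of_card_pairSums_le`); window form `Census.eighteen_box24_of_forall_ne` by the transports `Census.posRootLawOn_box_of_sorted_except`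
(…SidonBoxKit) / `Census.eighteen_box24_caseC_of_forall_ne`.  The excepted supports are OPEN at the cell's instruments; NOTHING is claimed about them.  Nothing here
bears on `ζ_sym(2,6)` over all supports (registers unchanged), on `DoorA26` itself, on `MatrixDescartes` (stmt-ValiantsHypothesis-18050) or on `VP ≠ VNP`.

[folklore] Bookkeeping over kernel rows; elementary.
-/

-- the D-0017 layout repeats a namespace component (single-conjunct summit); the `dupNamespace` linter flags it; name mandated.
set_option linter.dupNamespace false

namespace Summit.ValiantsHypothesis.ValiantsHypothesis.Theorems.LacunarySymmetroidMatrixDescartes.Census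

open Summit.ValiantsHypothesis.ValiantsHypothesis.Theorems.MatrixDescartes.Negative (PosRootLawAt)

/-- **THE BOX-24 EIGHTEEN STATEMENT minus NAMED EXCEPTIONS, sorted form (kernel)**: every sorted support `0 = d₀ < ⋯ < d₅ ≤ 24` outside the named
exception lists has `ζ(2,6; d) ≤ 18`. [folklore] -/
theorem eighteen_box24_sorted_of_not_mem (d : Fin 6 → ℕ) (hd : StrictMono d) (h0 : d 0 = 0) (h5 : d 5 ≤ 24)
    (hexS22 : [d 0, d 1, d 2, d 3, d 4, d 5] ∉ V19S.s2122OpenR3) (hexS24 : [d 0, d 1, d 2, d 3, d 4, d 5] ∉ V19S.s2324OpenR2)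
    (hexC : [d 0, d 1, d 2, d 3, d 4, d 5] ∉ V19C.caseC18Open ++ V19C.caseC20Open ++ V19C.caseC22Open ++ V19C.caseC2324Open) : PosRootLawOn 2 6 18 d := by
  by_cases h21 : 21 ≤ ((Finset.univ : Finset (Fin 6 × Fin 6)).image (fun p => d p.1 + d p.2)).card
  · by_cases h20' : d 5 ≤ 20
    · exact doorA26_sidon_box20 d hd h0 h20' h21
    · by_cases h22 : d 5 ≤ 22
      · exact V19S.eighteen_sidon_shells2122R3_sorted d hd h0 (by omega) h22 (sidon_of_card_pairSums d h21) hexS22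
      · exact V19S.eighteen_sidon_shells2324R2_sorted d hd h0 (by omega) h5 (sidon_of_card_pairSums d h21) hexS24
  · by_cases h20 : ((Finset.univ : Finset (Fin 6 × Fin 6)).image (fun p => d p.1 + d p.2)).card = 20
    · exact V19C.caseC_box24_sorted d hd h0 h5 h20 hexC
    · exact doorA26_box18_of_card_pairSums_le d (by omega)

/-- **THE BOX-24 EIGHTEEN STATEMENT minus NAMED EXCEPTIONS, window form (kernel)**: every exponent vector `d : Fin 6 → ℕ` with entries in a window of width `24`
satisfies `ζ(2,6; d) ≤ 18` unless a re-indexed translate of it is one of the named exceptions. [folklore] -/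
theorem eighteen_box24_of_forall_ne (d : Fin 6 → ℕ) (hw : ∀ i j, d i ≤ d j + 24)
    (hexS22 : ∀ v ∈ V19S.s2122OpenR3, ∀ (σ : Equiv.Perm (Fin 6)) (c : ℕ), (d ∘ σ) ≠ fun l => v.getD l.val 0 + c)
    (hexS24 : ∀ v ∈ V19S.s2324OpenR2, ∀ (σ : Equiv.Perm (Fin 6)) (c : ℕ), (d ∘ σ) ≠ fun l => v.getD l.val 0 + c)
    (hexC : ∀ v ∈ V19C.caseC18Open ++ V19C.caseC20Open ++ V19C.caseC22Open ++ V19C.caseC2324Open, ∀ (σ : Equiv.Perm (Fin 6)) (c : ℕ), (d ∘ σ) ≠ fun l => v.getD l.val 0 + c) :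
    PosRootLawOn 2 6 18 d := by
  by_cases h20 : ((Finset.univ : Finset (Fin 6 × Fin 6)).image (fun p => d p.1 + d p.2)).card = 20
  · exact eighteen_box24_caseC_of_forall_ne d hw h20 hexC
  · by_cases h21 : 21 ≤ ((Finset.univ : Finset (Fin 6 × Fin 6)).image (fun p => d p.1 + d p.2)).card
    · refine posRootLawOn_box_of_sorted_except 18 24 (((V19S.s2122OpenR3).map fun v l => v.getD l.val 0) ++ ((V19S.s2324OpenR2).map fun v l => v.getD l.val 0)) ?_ d hw h21 ?_
      · intro e he he0 he5 h21e hexe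
        rw [List.mem_append, not_or] at hexe
        by_cases h20' : e 5 ≤ 20
        · exact doorA26_sidon_box20 e he he0 h20' h21e
        · by_cases h22 : e 5 ≤ 22
          · refine V19S.eighteen_sidon_shells2122R3_sorted e he he0 (by omega) h22 (sidon_of_card_pairSums e h21e) (fun hmem => hexe.1 ?_)
            rw [List.mem_map]; exact ⟨_, hmem, by funext l; fin_cases l <;> rfl⟩
          · refine V19S.eighteen_sidon_shells2324R2_sorted e he he0 (by omega) he5 (sidon_of_card_pairSums e h21e) (fun hmem => hexe.2 ?_)
            rw [List.mem_map]; exact ⟨_, hmem, by funext l; fin_cases l <;> rfl⟩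
      · intro v hv σ c
        rw [List.mem_append] at hv
        rcases hv with hv | hv
        · rw [List.mem_map] at hv
          obtain ⟨w, hw', rfl⟩ := hv
          exact hexS22 w hw' σ c
        · rw [List.mem_map] at hv
          obtain ⟨w, hw', rfl⟩ := hv
          exact hexS24 w hw' σ c
    · exact doorA26_box18_of_card_pairSums_le d (by omega)

end Summit.ValiantsHypothesis.ValiantsHypothesis.Theorems.LacunarySymmetroidMatrixDescartes.Census
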